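import Mathlib
import Summits.CriticalPhenomena.PercolationContinuityZ3.Theorems.PercNearOneGluingNoHeavyLowerTailOrientedAntipodalHallTypeTSocket
import Summits.CriticalPhenomena.PercolationContinuityZ3.Theorems.PercNearOneGluingNoHeavyLowerTailOrientedAntipodalHallPencilLemma

/-!
# Criterion `C0` gives the three-family count `MS3′` (the gen-19 reduction, assembled)

Helper file for crux `stmt-CriticalPhenomena-4575` (`NoHeavyLowerTail`, route `PercNearOneGluingNoHeavy`),
new-inequality factory seat `prim-ineq-gen-3` (gen 19).  Everything here is PROVED; no definitions.

For pairwise disjoint families `P, Q, R` let `T = (P ∪ Q) \\ (P ∪ Q) ∪ (Q ∪ R) \\ (Q ∪ R) ∪ P ⊼ R` (the `MS3′` words), and consider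
the rows `A s = [E ⊆ s]` for `s ∈ P ∪ Q`, `A s = [E ∩ s = ∅]` for `s ∈ R` ('`P ∪ Q` plain, `R` complemented') and the perturbation
`B s = [E ∩ s = ∅]` for `s ∈ Q`, `B s = 0` otherwise, so that `A s + t • B s` are the `TYPE-t` rows `(0, t, ∞)` of the memo
`run/shared/lean/prim/prim-ineq-gen-3/CONJECTURE-TYPET.md`.  CRITERION `C0` (memo §3; verified in every instance tested, open in
general): a coefficient vector `d` killing the rows `A` whose `B`-combination lies in the span of the rows `A` is zero.
`card_le_card_threeFamilyWords_of_C0`: `C0` ⟹ `#P + #Q + #R ≤ #T` (pencil lemma + socket).  With gen 18's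
`card_le_card_wordsTwo_of_transitiveTriangle` this is the W2 count for transitive-triangle families whose member families satisfy `C0`.
(prim-ineq-gen-3 gen 19, 2026-08-23.)
-/

namespace Summit.CriticalPhenomena.PercolationContinuityZ3.Theorems

namespace OrientedAntipodalHall

open Finset
open scoped FinsetFamily

variable {α : Type*} [DecidableEq α]

/-- **`C0 ⟹ MS3′` count.**  If the criterion `C0` holds for the rows `A` (`P ∪ Q` plain, `R` complemented) and the perturbation
`B` (complemented `Q`-rows) over the `MS3′` word family `T`, then `#P + #Q + #R ≤ #T`. -/
theorem card_le_card_threeFamilyWords_of_C0 (P Q R : Finset (Finset α))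
    (hPQ : Disjoint P Q) (hQR : Disjoint Q R) (hPR : Disjoint P R)
    (hC0 : ∀ d : ↥(P ∪ Q ∪ R) → ℚ,
      (∑ s, d s • (fun E : ↥((P ∪ Q) \\ (P ∪ Q) ∪ (Q ∪ R) \\ (Q ∪ R) ∪ P ⊼ R) =>
        if (s : Finset α) ∈ R then (if Disjoint (E : Finset α) s then (1 : ℚ) else 0)
        else (if (E : Finset α) ⊆ s then (1 : ℚ) else 0))) = 0 →
      (∑ s, d s • (fun E : ↥((P ∪ Q) \\ (P ∪ Q) ∪ (Q ∪ R) \\ (Q ∪ R) ∪ P ⊼ R) =>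
        if (s : Finset α) ∈ Q then (if Disjoint (E : Finset α) s then (1 : ℚ) else 0) else 0)) ∈
        Submodule.span ℚ (Set.range (fun s : ↥(P ∪ Q ∪ R) =>
          fun E : ↥((P ∪ Q) \\ (P ∪ Q) ∪ (Q ∪ R) \\ (Q ∪ R) ∪ P ⊼ R) =>
            if (s : Finset α) ∈ R then (if Disjoint (E : Finset α) s then (1 : ℚ) else 0)
            else (if (E : Finset α) ⊆ s then (1 : ℚ) else 0))) →
      d = 0) :
    #P + #Q + #R ≤ #((P ∪ Q) \\ (P ∪ Q) ∪ (Q ∪ R) \\ (Q ∪ R) ∪ P ⊼ R) := by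
  classical
  obtain ⟨t, hlin⟩ := exists_linearIndependent_add_smul _ _ hC0
  have h := card_le_card_of_linearIndependent_vectors (P ∪ Q ∪ R) _ _ hlin
  have hcard : #(P ∪ Q ∪ R) = #P + #Q + #R := by
    rw [card_union_of_disjoint (disjoint_union_left.mpr ⟨hPR, hQR⟩), card_union_of_disjoint hPQ]
  omega

end OrientedAntipodalHall

end Summit.CriticalPhenomena.PercolationContinuityZ3.Theorems
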